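import Summits.QuantumFields.BalabanUV.Beta.RemainderExplicitHistoryDiagonalForwardStep

/-!
# RemainderExplicitHistoryDiagonalPositionMonotone — ROAD P3, ORDER-0 PROFILE FAMILY: EXACT MONOTONICITY OF THE MATCHED DISCREPANCY IN THE
# POSITION FOR EVERY NON-INCREASING PROFILE — for two infrared-pinned runs (A: `K` steps, B: `K + 1` steps) of
# `β_{k+1} = b + Σ_{a≤k} ρ(a)·min(g_k, |g_k − g_{k−a}|)` in ]0,γ] with ANY `ρ ≥ 0` non-increasing on the positive ages, `Σρ ≤ W`, `4Wγ ≤ b`, and NO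
# MEMORY HYPOTHESIS: `d_{j+1} ≤ d_j` at EVERY position `j < K` (`d_j = 1∕(g^B_{j+1})² − 1∕(g^A_j)²`); family form: along every run of a pinned family
# the continuum correction `astar g m − invSq g m j` grows towards the ultraviolet end — census item (i′) of generations 50–54 SETTLED IN FULL
# GENERALITY (station S-d4p3-g55-1 «one forward induction», third and closing file)

Cell `pub-balaban`, β-function sub-cell, BINDER row D4 «RemainderConst leaves for Bałaban's split» (`HOME/BINDER-OWNERS.md`; owner lineage
`b2b-balaban-beta-an4`; this file by co-owner #3 lineage `b2b-balaban-beta-d4-p3`, road P3 «the reduction road», generation 55, station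
S-d4p3-g55-1, closing file; imports the station's second file `RemainderExplicitHistoryDiagonalForwardStep` (hence the first, `…RunEnvelope`, and
generations 49–54's `…MemoryZoneCubic`, `…MemoryZone`, `…EchoMonotone`, `…OneStepMonotone`, `…Comparison`, `…Window`, `…TwoRun`, `…Weights`,
`…Monotone`)), β-FLOW TEAM duty (1); FREEZE (0) honoured (def-free module in road P3's own `RemainderExplicit*` series; no leaf, no interface, no
Literature file).  SOURCE OF THE SHAPES ONLY: [Balaban1987RG1] (0.20) p. 256, (0.31) and Thm 2 p. 259, §5 p. 298.  [folklore] real analysis about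
ONE explicit toy family (ours), road P3's ORDER-0 PROFILE FAMILY (generation 44).
HONEST FRAMING: *"Discharging BetaPertH makes Bałaban's UV stability UNCONDITIONAL — a real constructive-QFT result; it is NOT the continuum
limit and NOT the Clay problem."*  THIS FILE DISCHARGES NOTHING OF THE KIND; nothing of Bałaban's (1.22) is asserted or constructed; row D4
class UNCHANGED (critical-path width 0; instance 0∕1; D4 DISCHARGE NO DATE); NOT B12 Thm 2, NOT BetaPertH, NOT continuum, NOT Clay.  HONEST
DEPENDENCY: continuum YM on T⁴ ⇐ BetaPertH ∧ nine spine estimates (0/9 proved); BetaPertH ⇐ (D1) ∧ (D4) ∧ CAP+tail; G-an2-4 gates asym, D1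
and NE2/3/4.  ABSOLUTE RULE: nothing is cited as a fact.  All letters NOT-IN-PRINT; `BetaFlowAsPrinted S` records a Markov β_n only.

THE ARGUMENT (census item (i′): generation 53 proved one-step memory, generation 54 the source-free stretch (echo count), memory ≤ 3 and the
last memory positions; the general memory zone stayed OPEN).  By the second file, `d_{j+1} ≤ d_j` everywhere follows from two scalar inequalities at each position `1 ≤ j ≤ K − 2`:
`(K − j)κ₂∕2 ≤ Θ_j` and `(κ₂∕2)·U′_j ≤ Θ_j·E′_j`.  The first file gives `Θ_j ≥ 13∕24 + (K − j)κ₂∕2` under `4Wγ ≤ b`.  §1 here proves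
`(κ₂∕2)·U′_j ≤ (121∕384)·E′_j`: with `κ₂ = C + ρ(j+1)(g^A_j)³` (`C = Σ_{i<j} ρ(j−i)((g^A_j)³ − (g^A_i)³)`) and
`U′_j = (g^A_j − g^B_0)·Σ_{l∈[j,K)} ρ(l+1) + Σ_{l∈[j,K)} ρ(l+1)(g^A_l − g^A_j)`, the four products are at most `1∕16`, `15∕128`, `1∕32`, `5∕48` times
`E′_j = ρ(j+1)(g^A_j − g^B_0)` — by the monotone profile (`ρ(l+1) ≤ ρ(j+1)`, `C ≤ (g^A_j)³·Σ_{i<j}ρ(j−i)`), the linear form of the cubic excess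
(`…MemoryZoneCubic.cubic_sum_le_histA`: `C ≤ 3(g^A_j)²·W·(g^A_j − g^B_0)`), the spread bound and the ultraviolet suppression of the first file, the
first-increments bound `(g^A_j)³∕2 ≤ (g^A_j − g^A_0)(1∕(jb) + (g^A_j)²)`, and Chebyshev's sum inequality — the profile's total mass, not its shape,
prices the far positions.  `121∕384 ≤ 13∕24` closes the induction (§2).  §3: the family forms (every shift `n` by `shift_mono_of_succ_mono`; `astar`).

WHAT IS PROVED ([folklore]; 0 sorry; 0 `def`).  §1 **`excess_source_le`**.  §2 **`disc_succ_le_disc`** (two runs `K`, `K + 1`: `d_{j+1} ≤ d_j` for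
every `j < K`, every non-increasing profile, `4Wγ ≤ b`), **`disc_step_ge_source`** (`d_j − d_{j+1} ≥ (87∕208)·ρ(j+1)(g^A_j − g^B_0)` on `1 ≤ j ≤ K − 2`).  §3 **`invSq_shift_mono_position`** (all `m, j, n`), **`astar_sub_invSq_mono_position`**.
-/

noncomputable section

open Finset Filter Topology

namespace Summit.QuantumFields.BalabanUV.Beta.RemainderExplicitHistoryDiagonalPositionMonotone

open Literature.MathematicalPhysics.QuantumFieldTheory.Balaban1983to89
open Literature.MathematicalPhysics.QuantumFieldTheory.Balaban1983to89.FlowStep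
open Literature.MathematicalPhysics.QuantumFieldTheory.Balaban1983to89.T4CouplingMatching
open Literature.MathematicalPhysics.QuantumFieldTheory.Balaban1983to89.T4ContinuumCoupling
open Summit.QuantumFields.BalabanUV.Beta.RemainderExplicitHistoryDiagonalMonotone
open Summit.QuantumFields.BalabanUV.Beta.RemainderExplicitHistoryDiagonalWeights
open Summit.QuantumFields.BalabanUV.Beta.RemainderExplicitHistoryDiagonalTwoRun
open Summit.QuantumFields.BalabanUV.Beta.RemainderExplicitHistoryDiagonalOneStepMonotone
open Summit.QuantumFields.BalabanUV.Beta.RemainderExplicitHistoryDiagonalEchoMonotone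
open Summit.QuantumFields.BalabanUV.Beta.RemainderExplicitHistoryDiagonalMemoryZoneCubic
open Summit.QuantumFields.BalabanUV.Beta.RemainderExplicitHistoryDiagonalRunEnvelope
open Summit.QuantumFields.BalabanUV.Beta.RemainderExplicitHistoryDiagonalForwardStep

variable {β : HBeta} {b γ W : ℝ} {ρ : ℕ → ℝ}

/-! ## §1 The second scalar inequality in closed form -/

/-- **THE SECOND SCALAR INEQUALITY.**  Two pinned runs of the family in ]0,γ] (A: `K` steps, B: `K + 1` steps; profile non-increasing on the positive
ages, `Σ_{a<N} ρ(a) ≤ W`, `4Wγ ≤ b`) and a position `1 ≤ j ≤ K − 2`.  THEN `(κ₂∕2)·U′_j ≤ (121∕384)·E′_j`: splitting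
`U′_j = (g^A_j − g^B_0)·Σ_{l∈[j,K)} ρ(l+1) + Σ_{l∈[j,K)} ρ(l+1)(g^A_l − g^A_j)`, the four products are at most `Wγ∕(4b)`, `(3∕8)(1 + Wγ∕b)(Wγ∕b)`,
`Wγ∕(8b)` and `(1 + Wγ∕b)(Wγ∕b)(1∕j + 1∕K)∕4` times `E′_j` — by the monotone profile (`ρ(l+1) ≤ ρ(j+1)`), the cubic and linear forms of the
position excess (`…MemoryZoneCubic.cubic_sum_le_histA`), the spread bound `spread_le`, the ultraviolet suppression, `cube_le_incr_mul`, and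
Chebyshev's sum inequality `mul_sum_profile_spread_le` — i.e. at most `1∕16 + 15∕128 + 1∕32 + 5∕48 = 121∕384` under `4Wγ ≤ b`.
[cite: Balaban1987RG1, (0.20) p.256, (0.31) and Thm 2 p.259] -/
theorem excess_source_le
    (hβ : ∀ (k : ℕ) (p : Fin (k + 1) → ℝ),
      β k p = b + ∑ i : Fin (k + 1), ρ (k - i) * min (p (Fin.last k)) (|p (Fin.last k) - p i|))
    (hb : 0 < b) (hγ : 0 < γ) (hρ0 : ∀ a, 0 ≤ ρ a) (hρW : ∀ n, ∑ a ∈ range n, ρ a ≤ W) (hmono : ∀ a, 1 ≤ a → ρ (a + 1) ≤ ρ a)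
    (hWγ : 4 * (W * γ) ≤ b) {K : ℕ} {gA gB : ℕ → ℝ} (hA : RGEqH K β gA) (hB : RGEqH (K + 1) β gB)
    (hAbox : ∀ k, k ≤ K → 0 < gA k ∧ gA k ≤ γ) (hBpos : ∀ k, k ≤ K + 1 → 0 < gB k) (hpin : gA K = gB (K + 1)) {j : ℕ} (hj1 : 1 ≤ j)
    (hj2 : j + 2 ≤ K) :
    ((∑ i ∈ range j, ρ (j - i) * ((gA j) ^ 3 - (gA i) ^ 3)) + ρ (j + 1) * (gA j) ^ 3) / 2
        * ∑ l ∈ Ico j K, ρ (l + 1) * (gA l - gB 0)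
      ≤ 121 / 384 * (ρ (j + 1) * (gA j - gB 0)) := by
  have hApos : ∀ k, k ≤ K → 0 < gA k := fun k hk => (hAbox k hk).1
  have hdom := invSq_le_invSq_shift_run hβ hb hρ0 hA hB hApos hBpos hpin
  have hBA : ∀ i, i ≤ K → gB (i + 1) ≤ gA i := fun i hi =>
    le_of_one_div_sq_le (hApos i hi) (hBpos (i + 1) (by omega)) (hdom i hi)
  have hW : 0 ≤ W := by simpa using hρW 0
  have hw : W * γ / b ≤ 1 / 4 := by rw [div_le_iff₀ hb]; linarith only [hWγ]
  have hw0 : 0 ≤ W * γ / b := by positivity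
  have hjK : j ≤ K := by omega
  have hgj := hApos j hjK
  have hgK := hAbox K le_rfl
  have hmonoA : ∀ i k, i ≤ k → k ≤ K → gA i ≤ gA k := fun i k hik hk => run_mono_orderZero hβ hb hρ0 hA hApos hik hk
  -- names
  set C : ℝ := ∑ i ∈ range j, ρ (j - i) * ((gA j) ^ 3 - (gA i) ^ 3) with hC
  set R : ℝ := ∑ i ∈ range j, ρ (j - i) with hR
  set P : ℝ := ρ (j + 1) with hP
  set V : ℝ := gA j - gB 0 with hV
  set Q : ℝ := ∑ l ∈ Ico j K, ρ (l + 1) with hQ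
  set S : ℝ := ∑ l ∈ Ico j K, (gA l - gA j) with hS
  set U₂ : ℝ := ∑ l ∈ Ico j K, ρ (l + 1) * (gA l - gA j) with hU₂
  have hP0 : 0 ≤ P := hρ0 _
  have hR0 : 0 ≤ R := Finset.sum_nonneg fun i _ => hρ0 _
  have hB01 : gB 0 ≤ gB 1 := run_mono_orderZero hβ hb hρ0 hB hBpos (Nat.zero_le 1) (by omega)
  have hV0 : gA j - gA 0 ≤ V := by linarith only [hV, hB01, hBA 0 (Nat.zero_le K)]
  have hVpos : 0 ≤ V := by linarith only [hV0, hmonoA 0 j (Nat.zero_le j) hjK]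
  have hS0 : 0 ≤ S := Finset.sum_nonneg fun l hl =>
    sub_nonneg.mpr (hmonoA j l (Finset.mem_Ico.mp hl).1 (Finset.mem_Ico.mp hl).2.le)
  have hC0 : 0 ≤ C := Finset.sum_nonneg fun i hi => mul_nonneg (hρ0 _) (sub_nonneg.mpr
    (pow_le_pow_left₀ (hApos i (by have := Finset.mem_range.mp hi; omega)).le
      (hmonoA i j (Finset.mem_range.mp hi).le hjK) 3))
  have hU0 : 0 ≤ U₂ := Finset.sum_nonneg fun l hl => mul_nonneg (hρ0 _)
    (sub_nonneg.mpr (hmonoA j l (Finset.mem_Ico.mp hl).1 (Finset.mem_Ico.mp hl).2.le))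
  -- the split of `U′`
  have hsplitU : ∑ l ∈ Ico j K, ρ (l + 1) * (gA l - gB 0) = V * Q + U₂ := by
    rw [hQ, hU₂, Finset.mul_sum, ← Finset.sum_add_distrib]
    exact Finset.sum_congr rfl fun l _ => by rw [hV]; ring
  -- (f1) `C ≤ (g_j)³·R`, (f2) `R + P ≤ W`
  have hRP : R + P ≤ W := sum_shift_weights_le hρ0 hρW j
  have hRW : R ≤ W := by linarith only [hRP, hP0]
  have hf1 : C ≤ (gA j) ^ 3 * R := by
    rw [hC, hR, Finset.mul_sum]
    refine Finset.sum_le_sum fun i hi => ?_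
    have h := mul_nonneg (hρ0 (j - i)) (pow_pos (hApos i (by have := Finset.mem_range.mp hi; omega)) 3).le
    linarith only [h]
  -- (f3) `Q ≤ (K − j)·P` and `Q ≤ W`
  have hf3 : Q ≤ ((K - j : ℕ) : ℝ) * P := by
    have : Q ≤ ∑ l ∈ Ico j K, P := Finset.sum_le_sum fun l hl =>
      profile_le_of_le hmono (by omega) (by have := (Finset.mem_Ico.mp hl).1; omega)
    rwa [Finset.sum_const, Nat.card_Ico, nsmul_eq_mul] at this
  have hf3' : Q ≤ W := by
    have h := hρW (K + 1)
    rw [Finset.sum_range_succ'] at h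
    have h' : Q ≤ ∑ l ∈ range K, ρ (l + 1) :=
      Finset.sum_le_sum_of_subset_of_nonneg (fun l hl => Finset.mem_range.mpr (Finset.mem_Ico.mp hl).2) fun l _ _ => hρ0 _
    linarith only [h, h', hρ0 0]
  -- (f4) `U₂ ≤ P·S`, (f5) `K·U₂ ≤ W·S`
  have hf4 : U₂ ≤ P * S := by
    rw [hU₂, hS, Finset.mul_sum]
    exact Finset.sum_le_sum fun l hl => mul_le_mul_of_nonneg_right
      (profile_le_of_le hmono (by omega) (by have := (Finset.mem_Ico.mp hl).1; omega))
      (sub_nonneg.mpr (hmonoA j l (Finset.mem_Ico.mp hl).1 (Finset.mem_Ico.mp hl).2.le))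
  have hf5 : (K : ℝ) * U₂ ≤ W * S := mul_sum_profile_spread_le hρ0 hρW hmono hmonoA hjK
  -- (f6) `C ≤ 3(g_j)²·W·V`
  have hf6 : C ≤ 3 * (gA j) ^ 2 * (W * V) := by
    have h := cubic_sum_le_histA hρ0 (fun i hi => hApos i (hi.trans hjK)) (fun i hi => hmonoA i j hi hjK)
    have h' : ∑ i ∈ range j, ρ (j - i) * (gA j - gA i) ≤ R * V := by
      rw [hR, Finset.sum_mul]
      refine Finset.sum_le_sum fun i hi => mul_le_mul_of_nonneg_left ?_ (hρ0 _)
      linarith only [hV0, hmonoA 0 i (Nat.zero_le i) (by have := Finset.mem_range.mp hi; omega)]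
    have hg2 : 0 ≤ 3 * (gA j) ^ 2 := by positivity
    calc C ≤ 3 * (gA j) ^ 2 * ∑ i ∈ range j, ρ (j - i) * (gA j - gA i) := h
      _ ≤ 3 * (gA j) ^ 2 * (R * V) := mul_le_mul_of_nonneg_left h' hg2
      _ ≤ 3 * (gA j) ^ 2 * (W * V) := mul_le_mul_of_nonneg_left (mul_le_mul_of_nonneg_right hRW hVpos) hg2
  -- (f7) `(g_j)³∕2 ≤ V·(1∕(jb) + (g_j)²)`
  have hf7 : (gA j) ^ 3 / 2 ≤ V * (1 / ((j : ℝ) * b) + (gA j) ^ 2) :=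
    (cube_le_incr_mul hβ hb hρ0 hA hAbox hj1 hjK).trans (mul_le_mul_of_nonneg_right hV0 (by positivity))
  -- (f8) the spread, (f9) the ultraviolet suppression at `j`
  have hf8 : S ≤ (b + W * γ) / (4 * b) * (((K - j : ℕ) : ℝ) * gA K) := spread_le hβ hb hρ0 hρW hA hAbox hjK
  have hf9 : b * ((K - j : ℕ) : ℝ) * (gA j) ^ 3 ≤ gA K / 2 := dist_mul_cube_le_half hβ hρ0 hA hAbox hjK
  have hf9' : b * ((K - j : ℕ) : ℝ) * (gA j) ^ 2 ≤ 1 := dist_mul_sq_le_one hβ hρ0 hA hAbox hjK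
  have hKj2 : (2 : ℝ) ≤ ((K - j : ℕ) : ℝ) := by
    have : 2 ≤ K - j := by omega
    exact_mod_cast this
  have hK3 : (3 : ℝ) ≤ (K : ℝ) := by exact_mod_cast (show 3 ≤ K by omega)
  have hj1' : (1 : ℝ) ≤ (j : ℝ) := by exact_mod_cast hj1
  have hPV : 0 ≤ P * V := mul_nonneg hP0 hVpos
  have hc0 : 0 ≤ (b + W * γ) / (4 * b) := by positivity
  have hcw : (b + W * γ) / (4 * b) = (1 + W * γ / b) / 4 := by field_simp
  -- ultraviolet suppression at `j` in the three forms used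
  have s1 : ((K - j : ℕ) : ℝ) * (gA j) ^ 2 ≤ 1 / b := by
    rw [le_div_iff₀ hb]; linarith only [hf9']
  have s3 : (gA j) ^ 3 ≤ γ / (4 * b) := by
    rw [le_div_iff₀ (by positivity)]
    have := mul_le_mul_of_nonneg_right hKj2 (by positivity : 0 ≤ b * (gA j) ^ 3)
    linarith only [this, hf9, hgK.2]
  have s4 : ((K - j : ℕ) : ℝ) * (gA j) ^ 3 ≤ γ / (2 * b) := by
    rw [le_div_iff₀ (by positivity)]; linarith only [hf9, hgK.2]
  -- the spread priced: `g_j²·S ≤ (1 + w′)∕4 · γ∕b` and `S ≤ (1 + w′)∕4 · K·γ`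
  have s2 : (gA j) ^ 2 * S ≤ (1 + W * γ / b) / 4 * (γ / b) := by
    calc (gA j) ^ 2 * S ≤ (gA j) ^ 2 * ((b + W * γ) / (4 * b) * (((K - j : ℕ) : ℝ) * gA K)) :=
          mul_le_mul_of_nonneg_left hf8 (by positivity)
      _ = (b + W * γ) / (4 * b) * gA K * (((K - j : ℕ) : ℝ) * (gA j) ^ 2) := by ring
      _ ≤ (b + W * γ) / (4 * b) * gA K * (1 / b) :=
          mul_le_mul_of_nonneg_left s1 (mul_nonneg hc0 hgK.1.le)
      _ ≤ (b + W * γ) / (4 * b) * γ * (1 / b) :=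
          mul_le_mul_of_nonneg_right (mul_le_mul_of_nonneg_left hgK.2 hc0) (by positivity)
      _ = (1 + W * γ / b) / 4 * (γ / b) := by rw [hcw]; ring
  have hKjK : ((K - j : ℕ) : ℝ) ≤ (K : ℝ) := by exact_mod_cast Nat.sub_le K j
  have sK : S ≤ (1 + W * γ / b) / 4 * ((K : ℝ) * γ) := by
    calc S ≤ (b + W * γ) / (4 * b) * (((K - j : ℕ) : ℝ) * gA K) := hf8
      _ ≤ (b + W * γ) / (4 * b) * ((K : ℝ) * γ) :=
          mul_le_mul_of_nonneg_left (mul_le_mul hKjK hgK.2 hgK.1.le (by positivity)) hc0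
      _ = (1 + W * γ / b) / 4 * ((K : ℝ) * γ) := by rw [hcw]
  -- T1 = (C∕2)·V·Q ≤ (1∕16)·P·V
  have hT1 : C / 2 * (V * Q) ≤ 1 / 16 * (P * V) := by
    have a1 : C / 2 * (V * Q) ≤ C / 2 * (V * (((K - j : ℕ) : ℝ) * P)) :=
      mul_le_mul_of_nonneg_left (mul_le_mul_of_nonneg_left hf3 hVpos) (by positivity)
    have e1 : C / 2 * (V * (((K - j : ℕ) : ℝ) * P)) = ((K - j : ℕ) : ℝ) * C / 2 * (P * V) := by ring
    have hCW : C ≤ (gA j) ^ 3 * W := hf1.trans (mul_le_mul_of_nonneg_left hRW (pow_pos hgj 3).le)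
    have a2 : ((K - j : ℕ) : ℝ) * C / 2 ≤ ((K - j : ℕ) : ℝ) * (gA j) ^ 3 / 2 * W := by
      have := mul_le_mul_of_nonneg_left hCW (Nat.cast_nonneg (K - j))
      linarith only [this]
    have a3 : ((K - j : ℕ) : ℝ) * (gA j) ^ 3 / 2 * W ≤ γ / (2 * b) / 2 * W :=
      mul_le_mul_of_nonneg_right (by linarith only [s4]) hW
    have a4 : γ / (2 * b) / 2 * W = (W * γ / b) / 4 := by field_simp; ring
    rw [e1] at a1
    exact a1.trans (mul_le_mul_of_nonneg_right (by linarith only [a2, a3, a4, hw]) hPV)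
  -- T2 = (C∕2)·U₂ ≤ (15∕128)·P·V
  have hT2 : C / 2 * U₂ ≤ 15 / 128 * (P * V) := by
    have a1 : C / 2 * U₂ ≤ C / 2 * (P * S) := mul_le_mul_of_nonneg_left hf4 (by positivity)
    have a2 : C / 2 * (P * S) ≤ 3 * (gA j) ^ 2 * (W * V) / 2 * (P * S) :=
      mul_le_mul_of_nonneg_right (by linarith only [hf6]) (mul_nonneg hP0 hS0)
    have e1 : 3 * (gA j) ^ 2 * (W * V) / 2 * (P * S) = 3 / 2 * W * ((gA j) ^ 2 * S) * (P * V) := by ring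
    have a3 : 3 / 2 * W * ((gA j) ^ 2 * S) ≤ 3 / 2 * W * ((1 + W * γ / b) / 4 * (γ / b)) :=
      mul_le_mul_of_nonneg_left s2 (by positivity)
    have e2 : 3 / 2 * W * ((1 + W * γ / b) / 4 * (γ / b)) = 3 / 8 * (1 + W * γ / b) * (W * γ / b) := by ring
    have a4 : 3 / 8 * (1 + W * γ / b) * (W * γ / b) ≤ 15 / 128 := by
      linarith only [mul_nonneg hw0 (sub_nonneg.mpr hw), hw, hw0]
    rw [e1] at a2
    exact (a1.trans a2).trans (mul_le_mul_of_nonneg_right (by linarith only [a3, e2, a4]) hPV)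
  -- T3 = (P(g_j)³∕2)·V·Q ≤ (1∕32)·P·V
  have hT3 : P * (gA j) ^ 3 / 2 * (V * Q) ≤ 1 / 32 * (P * V) := by
    have e1 : P * (gA j) ^ 3 / 2 * (V * Q) = (gA j) ^ 3 / 2 * Q * (P * V) := by ring
    have a1 : (gA j) ^ 3 / 2 * Q ≤ (gA j) ^ 3 / 2 * W := mul_le_mul_of_nonneg_left hf3' (by positivity)
    have a2 : (gA j) ^ 3 / 2 * W ≤ γ / (4 * b) / 2 * W := mul_le_mul_of_nonneg_right (by linarith only [s3]) hW
    have e2 : γ / (4 * b) / 2 * W = (W * γ / b) / 8 := by field_simp; ring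
    rw [e1]
    exact mul_le_mul_of_nonneg_right (by linarith only [a1, a2, e2, hw]) hPV
  -- T4 = (P(g_j)³∕2)·U₂ ≤ (5∕48)·P·V
  have hT4 : P * (gA j) ^ 3 / 2 * U₂ ≤ 5 / 48 * (P * V) := by
    have a1 : P * (gA j) ^ 3 / 2 * U₂ ≤ P * (V * (1 / ((j : ℝ) * b) + (gA j) ^ 2)) * U₂ := by
      have := mul_le_mul_of_nonneg_left hf7 hP0
      exact mul_le_mul_of_nonneg_right (by linarith only [this]) hU0
    have e1 : P * (V * (1 / ((j : ℝ) * b) + (gA j) ^ 2)) * U₂ = (1 / ((j : ℝ) * b) + (gA j) ^ 2) * U₂ * (P * V) := by ring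
    have hK0 : (0 : ℝ) < K := by linarith only [hK3]
    have u1 : U₂ ≤ W * S / K := by rw [le_div_iff₀ hK0]; linarith only [hf5]
    have hWSK : 0 ≤ W * S / K := by positivity
    -- piece 1: `(1∕(jb))·(W S∕K) ≤ w′(1 + w′)∕4`
    have p1 : 1 / ((j : ℝ) * b) * (W * S / K) ≤ (W * γ / b) * (1 + W * γ / b) / 4 := by
      have h1 : 1 / ((j : ℝ) * b) ≤ 1 / b := by
        rw [div_le_div_iff_of_pos_left one_pos (by positivity) hb]
        have := mul_le_mul_of_nonneg_right hj1' hb.le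
        linarith only [this]
      have h2 : 1 / ((j : ℝ) * b) * (W * S / K) ≤ 1 / b * (W * S / K) := mul_le_mul_of_nonneg_right h1 hWSK
      have h3 : W * S / K ≤ W * ((1 + W * γ / b) / 4 * ((K : ℝ) * γ)) / K :=
        div_le_div_of_nonneg_right (mul_le_mul_of_nonneg_left sK hW) hK0.le
      have e2 : W * ((1 + W * γ / b) / 4 * ((K : ℝ) * γ)) / K = W * γ * (1 + W * γ / b) / 4 := by
        field_simp
      have h4 := mul_le_mul_of_nonneg_left (h3.trans e2.le) (by positivity : 0 ≤ 1 / b)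
      have e3 : 1 / b * (W * γ * (1 + W * γ / b) / 4) = (W * γ / b) * (1 + W * γ / b) / 4 := by field_simp
      linarith only [h2, h4, e3]
    -- piece 2: `(g_j)²·(W S∕K) ≤ w′(1 + w′)∕12`
    have p2 : (gA j) ^ 2 * (W * S / K) ≤ (W * γ / b) * (1 + W * γ / b) / 12 := by
      have e2 : (gA j) ^ 2 * (W * S / K) = W * ((gA j) ^ 2 * S) / K := by ring
      have h1 : W * ((gA j) ^ 2 * S) ≤ W * ((1 + W * γ / b) / 4 * (γ / b)) := mul_le_mul_of_nonneg_left s2 hW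
      have h2 : W * ((gA j) ^ 2 * S) / K ≤ W * ((1 + W * γ / b) / 4 * (γ / b)) / K := div_le_div_of_nonneg_right h1 hK0.le
      have h3 : W * ((1 + W * γ / b) / 4 * (γ / b)) / K ≤ W * ((1 + W * γ / b) / 4 * (γ / b)) / 3 :=
        div_le_div_of_nonneg_left (by positivity) (by norm_num) hK3
      have e3 : W * ((1 + W * γ / b) / 4 * (γ / b)) / 3 = (W * γ / b) * (1 + W * γ / b) / 12 := by ring
      linarith only [e2, h2, h3, e3]
    have a2 : (1 / ((j : ℝ) * b) + (gA j) ^ 2) * U₂ ≤ 5 / 48 := by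
      have h1 : (1 / ((j : ℝ) * b) + (gA j) ^ 2) * U₂ ≤ (1 / ((j : ℝ) * b) + (gA j) ^ 2) * (W * S / K) :=
        mul_le_mul_of_nonneg_left u1 (by positivity)
      have h2 : (W * γ / b) * (1 + W * γ / b) / 4 + (W * γ / b) * (1 + W * γ / b) / 12 ≤ 5 / 48 := by
        linarith only [mul_nonneg hw0 (sub_nonneg.mpr hw), hw, hw0]
      have e4 : (1 / ((j : ℝ) * b) + (gA j) ^ 2) * (W * S / K)
          = 1 / ((j : ℝ) * b) * (W * S / K) + (gA j) ^ 2 * (W * S / K) := by ring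
      linarith only [h1, e4, p1, p2, h2]
    rw [e1] at a1
    exact a1.trans (mul_le_mul_of_nonneg_right a2 hPV)
  -- assemble
  rw [hsplitU]
  have e : (C + P * (gA j) ^ 3) / 2 * (V * Q + U₂)
      = C / 2 * (V * Q) + C / 2 * U₂ + P * (gA j) ^ 3 / 2 * (V * Q) + P * (gA j) ^ 3 / 2 * U₂ := by ring
  rw [e]
  linarith only [hT1, hT2, hT3, hT4]

/-! ## §2 Exact monotonicity in the position, for every non-increasing profile -/

/-- **EXACT MONOTONICITY OF THE MATCHED DISCREPANCY IN THE POSITION, FOR EVERY NON-INCREASING PROFILE.**  Road P3's order-0 profile family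
`β_{k+1} = b + Σ_{a≤k} ρ(a)·min(g_k, |g_k − g_{k−a}|)` in ]0,γ] (`b, γ > 0`) with ANY profile `ρ ≥ 0` non-increasing on the positive ages,
`Σ_{a<N} ρ(a) ≤ W`, and `4Wγ ≤ b` — NO memory hypothesis; two runs in the box — A: `K` steps, B: `K + 1` steps — pinned `g^A_K = g^B_{K+1}`.  THEN
`1∕(g^B_{j+2})² − 1∕(g^A_{j+1})² ≤ 1∕(g^B_{j+1})² − 1∕(g^A_j)²` for EVERY `j < K`: the matched discrepancy is non-increasing towards the pin at
every position.  One forward induction (`…ForwardStep.disc_succ_le_disc_of_forward_all`) with both scalar inequalities in closed form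
(`theta_lower`, `excess_source_le`; `121∕384 ≤ 13∕24`).  Census item (i′) of generations 50–54 SETTLED in full generality; the earlier cases
(one-, two-, three-step memory, the source-free stretch, the last memory positions) are contained. [cite: Balaban1987RG1, (0.20) p.256, (0.31) and Thm 2 p.259] -/
theorem disc_succ_le_disc
    (hβ : ∀ (k : ℕ) (p : Fin (k + 1) → ℝ),
      β k p = b + ∑ i : Fin (k + 1), ρ (k - i) * min (p (Fin.last k)) (|p (Fin.last k) - p i|))
    (hb : 0 < b) (hγ : 0 < γ) (hρ0 : ∀ a, 0 ≤ ρ a) (hρW : ∀ n, ∑ a ∈ range n, ρ a ≤ W) (hmono : ∀ a, 1 ≤ a → ρ (a + 1) ≤ ρ a)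
    (hWγ : 4 * (W * γ) ≤ b) {K : ℕ} {gA gB : ℕ → ℝ} (hA : RGEqH K β gA) (hB : RGEqH (K + 1) β gB)
    (hAbox : ∀ k, k ≤ K → 0 < gA k ∧ gA k ≤ γ) (hBpos : ∀ k, k ≤ K + 1 → 0 < gB k) (hpin : gA K = gB (K + 1)) :
    ∀ j, j < K → 1 / (gB (j + 1 + 1)) ^ 2 - 1 / (gA (j + 1)) ^ 2 ≤ 1 / (gB (j + 1)) ^ 2 - 1 / (gA j) ^ 2 := by
  have hW : 0 ≤ W := by simpa using hρW 0
  have hWγ1 : W * γ < b := by nlinarith [mul_nonneg hW hγ.le]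
  refine disc_succ_le_disc_of_forward_all hβ hb hγ hρ0 hρW hmono hWγ1 hA hB hAbox hBpos hpin fun j hj1 hj2 => ?_
  have hΘ := theta_lower hβ hb hγ hρ0 hρW hWγ hA hAbox (j := j) (by omega)
  have hκ := kappa_nonneg hβ hb hρ0 hA hAbox (j := j) (by omega)
  have h2 := excess_source_le hβ hb hγ hρ0 hρW hmono hWγ hA hB hAbox hBpos hpin hj1 hj2
  have hKj : 0 ≤ ((K - j : ℕ) : ℝ) := Nat.cast_nonneg _
  have hE : 0 ≤ ρ (j + 1) * (gA j - gB 0) := by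
    refine mul_nonneg (hρ0 _) ?_
    have hApos : ∀ k, k ≤ K → 0 < gA k := fun k hk => (hAbox k hk).1
    have hdom := invSq_le_invSq_shift_run hβ hb hρ0 hA hB hApos hBpos hpin
    have h0 := le_of_one_div_sq_le (hApos 0 (Nat.zero_le K)) (hBpos 1 (by omega)) (hdom 0 (Nat.zero_le K))
    have h1 := run_mono_orderZero hβ hb hρ0 hB hBpos (Nat.zero_le 1) (by omega)
    have h2 := run_mono_orderZero hβ hb hρ0 hA hApos (Nat.zero_le j) (by omega)
    linarith
  refine ⟨by nlinarith [mul_nonneg hKj hκ], by linarith, h2.trans ?_⟩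
  nlinarith [mul_nonneg hKj hκ]


/-- **THE DECREMENT IN THE MEMORY ZONE IS AT LEAST A FIXED FRACTION OF THE SOURCE.**  Same setting: for every `1 ≤ j ≤ K − 2`,
`(87∕208)·ρ(j+1)(g^A_j − g^B_0) ≤ d_j − d_{j+1}` (`≥ (87∕208)·E_j`): the quantitative forward step (`…ForwardStep.disc_step_ge_of_forward`, the past
dominating by `disc_succ_le_disc`) with `Θ_j ≥ 13∕24` and `(κ₂∕2)U′_j ≤ (121∕384)E′_j`; position `0`: `d_0 − d_1 = E_0` exactly; the companion of the
stretch law `d_j − d_{j+1} ≥ (1 − Wγ∕(2b))·Σ_{i<j}ρ(j−i)e_i` of generation 54. [cite: Balaban1987RG1, (0.20) p.256, (0.31) and Thm 2 p.259] -/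
theorem disc_step_ge_source
    (hβ : ∀ (k : ℕ) (p : Fin (k + 1) → ℝ),
      β k p = b + ∑ i : Fin (k + 1), ρ (k - i) * min (p (Fin.last k)) (|p (Fin.last k) - p i|))
    (hb : 0 < b) (hγ : 0 < γ) (hρ0 : ∀ a, 0 ≤ ρ a) (hρW : ∀ n, ∑ a ∈ range n, ρ a ≤ W) (hmono : ∀ a, 1 ≤ a → ρ (a + 1) ≤ ρ a)
    (hWγ : 4 * (W * γ) ≤ b) {K : ℕ} {gA gB : ℕ → ℝ} (hA : RGEqH K β gA) (hB : RGEqH (K + 1) β gB)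
    (hAbox : ∀ k, k ≤ K → 0 < gA k ∧ gA k ≤ γ) (hBpos : ∀ k, k ≤ K + 1 → 0 < gB k) (hpin : gA K = gB (K + 1)) {j : ℕ} (hj1 : 1 ≤ j)
    (hj2 : j + 2 ≤ K) :
    87 / 208 * (ρ (j + 1) * (gA j - gB 0))
      ≤ (1 / (gB (j + 1)) ^ 2 - 1 / (gA j) ^ 2) - (1 / (gB (j + 1 + 1)) ^ 2 - 1 / (gA (j + 1)) ^ 2) := by
  have hW : 0 ≤ W := by simpa using hρW 0
  have hWγ1 : W * γ < b := by nlinarith [mul_nonneg hW hγ.le]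
  have hmonoD := disc_succ_le_disc hβ hb hγ hρ0 hρW hmono hWγ hA hB hAbox hBpos hpin
  have hdomPast : ∀ i, i < j → 1 / (gB (j + 1)) ^ 2 - 1 / (gA j) ^ 2 ≤ 1 / (gB (i + 1)) ^ 2 - 1 / (gA i) ^ 2 :=
    fun i hi => disc_le_disc_of_succ_le hmonoD hi.le (by omega)
  have hΘ := theta_lower hβ hb hγ hρ0 hρW hWγ hA hAbox (j := j) (by omega)
  have hκ := kappa_nonneg hβ hb hρ0 hA hAbox (j := j) (by omega)
  have hKj : 0 ≤ ((K - j : ℕ) : ℝ) := Nat.cast_nonneg _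
  have hstep := disc_step_ge_of_forward hβ hb hγ hρ0 hρW hmono hWγ1 hA hB hAbox hBpos hpin (by omega) hdomPast
    (by linarith [mul_nonneg hKj hκ])
  have h2 := excess_source_le hβ hb hγ hρ0 hρW hmono hWγ hA hB hAbox hBpos hpin hj1 hj2
  have hE : 0 ≤ ρ (j + 1) * (gA j - gB 0) := by
    refine mul_nonneg (hρ0 _) ?_
    have hApos : ∀ k, k ≤ K → 0 < gA k := fun k hk => (hAbox k hk).1
    have hdom := invSq_le_invSq_shift_run hβ hb hρ0 hA hB hApos hBpos hpin
    have h0 := le_of_one_div_sq_le (hApos 0 (Nat.zero_le K)) (hBpos 1 (by omega)) (hdom 0 (Nat.zero_le K))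
    have h1 := run_mono_orderZero hβ hb hρ0 hB hBpos (Nat.zero_le 1) (by omega)
    have h3 := run_mono_orderZero hβ hb hρ0 hA hApos (Nat.zero_le j) (by omega)
    linarith
  set Θ : ℝ := 1 - ((K - j : ℕ) : ℝ) * (∑ i ∈ range j, ρ (j - i) * (gA i) ^ 3) / 2
      - (∑ i ∈ Ico j K, (W - ∑ a ∈ range (i + 1), ρ a) * (gA i) ^ 3) / (2 * (1 - W * γ / b)) with hΘdef
  set E : ℝ := ρ (j + 1) * (gA j - gB 0) with hEdef
  have hΘ13 : 13 / 24 ≤ Θ := by linarith [mul_nonneg hKj hκ]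
  have hΘpos : 0 < Θ := by linarith
  have key : Θ * (87 / 208 * E) ≤ Θ * ((1 / (gB (j + 1)) ^ 2 - 1 / (gA j) ^ 2) - (1 / (gB (j + 1 + 1)) ^ 2 - 1 / (gA (j + 1)) ^ 2)) := by
    have h3 : Θ * (87 / 208 * E) ≤ Θ * E - 121 / 384 * E := by linarith [mul_nonneg (sub_nonneg.2 hΘ13) hE]
    linarith
  exact le_of_mul_le_mul_left key hΘpos

/-! ## §3 Pinned family: every shift, and the continuum correction grows towards the ultraviolet end of every run -/

/-- **FAMILY FORM, EVERY NON-INCREASING PROFILE** (`g K` the run with `K` steps in ]0,γ], `g K K = g_IR`; `ρ` non-increasing on the positive ages,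
`Σ_{a<N} ρ(a) ≤ W`, `4Wγ ≤ b`): `invSq g m (j+1+n) − invSq g m (j+1) ≤ invSq g (m+1) (j+n) − invSq g (m+1) j` for all `m, j, n` — shift `1` at every
run length by `disc_succ_le_disc`, every shift by generation 53's `…OneStepMonotone.shift_mono_of_succ_mono`. [cite: Balaban1987RG1, (0.20) p.256, (0.31) and Thm 2 p.259] -/
theorem invSq_shift_mono_position
    (hβ : ∀ (k : ℕ) (p : Fin (k + 1) → ℝ),
      β k p = b + ∑ i : Fin (k + 1), ρ (k - i) * min (p (Fin.last k)) (|p (Fin.last k) - p i|))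
    (hb : 0 < b) (hγ : 0 < γ) (hρ0 : ∀ a, 0 ≤ ρ a) (hρW : ∀ n, ∑ a ∈ range n, ρ a ≤ W) (hmono : ∀ a, 1 ≤ a → ρ (a + 1) ≤ ρ a)
    (hWγ : 4 * (W * γ) ≤ b) {g : ℕ → ℕ → ℝ} {gIR : ℝ} (hrun : ∀ K, RGEqH K β (g K)) (hbox : ∀ K i, i ≤ K → 0 < g K i ∧ g K i ≤ γ)
    (hpin : ∀ K, g K K = gIR) (m j n : ℕ) :
    invSq g m (j + 1 + n) - invSq g m (j + 1) ≤ invSq g (m + 1) (j + n) - invSq g (m + 1) j := by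
  refine shift_mono_of_succ_mono (fun m j => invSq g m j) (fun m j => ?_) m j n
  have hA : RGEqH (j + 1 + m) β (g (j + 1 + m)) := hrun _
  have hB : RGEqH (j + 1 + m + 1) β (g (j + 1 + m + 1)) := hrun _
  have hpin' : g (j + 1 + m) (j + 1 + m) = g (j + 1 + m + 1) (j + 1 + m + 1) := by rw [hpin, hpin]
  have h := disc_succ_le_disc hβ hb hγ hρ0 hρW hmono hWγ hA hB (fun k hk => hbox _ k hk) (fun k hk => (hbox _ k hk).1) hpin' j (by omega)
  have e1 : invSq g m (j + 2) = 1 / (g (j + 1 + m + 1) (j + 1 + 1)) ^ 2 := by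
    rw [invSq_def, show j + 2 + m = j + 1 + m + 1 by omega]
  have e2 : invSq g m (j + 1) = 1 / (g (j + 1 + m) (j + 1)) ^ 2 := by rw [invSq_def]
  have e3 : invSq g (m + 1) (j + 1) = 1 / (g (j + 1 + m + 1) (j + 1)) ^ 2 := by
    rw [invSq_def, show j + 1 + (m + 1) = j + 1 + m + 1 by omega]
  have e4 : invSq g (m + 1) j = 1 / (g (j + 1 + m) j) ^ 2 := by
    rw [invSq_def, show j + (m + 1) = j + 1 + m by omega]
  show invSq g m (j + 2) - invSq g m (j + 1) ≤ invSq g (m + 1) (j + 1) - invSq g (m + 1) j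
  rw [e1, e2, e3, e4]
  exact h

/-- **THE CONTINUUM CORRECTION GROWS TOWARDS THE ULTRAVIOLET END OF EVERY RUN, FOR EVERY NON-INCREASING PROFILE**:
`astar g m − invSq g m (j+1) ≤ astar g (m+1) − invSq g (m+1) j` for all `m, j` (`n → ∞` in `invSq_shift_mono_position` by generation 47's
`continuum_monotone`). [cite: Balaban1987RG1, (0.20) p.256, (0.31) and Thm 2 p.259] -/
theorem astar_sub_invSq_mono_position
    (hβ : ∀ (k : ℕ) (p : Fin (k + 1) → ℝ),
      β k p = b + ∑ i : Fin (k + 1), ρ (k - i) * min (p (Fin.last k)) (|p (Fin.last k) - p i|))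
    (hb : 0 < b) (hγ : 0 < γ) (hρ0 : ∀ a, 0 ≤ ρ a) (hρW : ∀ n, ∑ a ∈ range n, ρ a ≤ W) (hmono : ∀ a, 1 ≤ a → ρ (a + 1) ≤ ρ a)
    (hWγ : 4 * (W * γ) ≤ b) {g : ℕ → ℕ → ℝ} {gIR : ℝ} (hrun : ∀ K, RGEqH K β (g K)) (hbox : ∀ K i, i ≤ K → 0 < g K i ∧ g K i ≤ γ)
    (hpin : ∀ K, g K K = gIR) (m j : ℕ) :
    astar g m - invSq g m (j + 1) ≤ astar g (m + 1) - invSq g (m + 1) j := by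
  have hlim := (continuum_monotone hβ hb hγ hρ0 hρW hrun hbox hpin).1
  have h1 : Tendsto (fun n => invSq g m (j + 1 + n) - invSq g m (j + 1)) atTop (𝓝 (astar g m - invSq g m (j + 1))) :=
    ((hlim m).comp (tendsto_atTop_atTop_of_monotone (fun a b hab => by omega) fun n => ⟨n, by omega⟩)).sub
      tendsto_const_nhds
  have h2 : Tendsto (fun n => invSq g (m + 1) (j + n) - invSq g (m + 1) j) atTop
      (𝓝 (astar g (m + 1) - invSq g (m + 1) j)) :=
    ((hlim (m + 1)).comp (tendsto_atTop_atTop_of_monotone (fun a b hab => by omega) fun n => ⟨n, by omega⟩)).sub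
      tendsto_const_nhds
  exact le_of_tendsto_of_tendsto' h1 h2 fun n => invSq_shift_mono_position hβ hb hγ hρ0 hρW hmono hWγ hrun hbox hpin m j n

end Summit.QuantumFields.BalabanUV.Beta.RemainderExplicitHistoryDiagonalPositionMonotone
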